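import Mathlib
import Literature.Analysis.FluidPDE.TaoCascadeODE
import HarnessLib

/-!
# `HeteroclinicTriggerChain` — crux `TriggerChainFrontStep` (item stmt-NavierStokesRegularity-22785):
  PARITY makes the trigger-free subspace invariant (why the (seed) clause is needed)

Under the (parity) clause of the trigger chain — every structure constant with an odd number of `i₁`-slots
vanishes — the cascade nonlinearity driving ANY trigger mode `(i₁, n)` is a sum of monomials each containing a
trigger amplitude. Hence a family with no trigger charged anywhere (`X i₁ ≡ 0`) feels no force on any trigger
(`quadTerm ε₀ α X i₁ n t = 0`): the trigger-free subspace (in particular the pure-carrier equilibrium family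
and every carrier/receiver configuration) is invariant for exact flows, for the unseeded table `α₀` AND for
the seed table `σ` alike. Ignition of the chain therefore needs a charged trigger in the datum (cf.
`triggerChainFrontStep_witness_datum_seeded`) and, from one level to the next, the (seed) coupling acting on
an already charged trigger. Pure finite algebra.

HONEST FRAMING: an elementary identity about Tao-type MODEL-lattice nonlinearities; helper for the crux, no
stub credit; nothing here is a statement about the Navier–Stokes equations; no summit, rung or crux is proved.
-/

noncomputable section

set_option linter.dupNamespace false

namespace Summit.NavierStokesRegularity.NavierStokesRegularity.Theorems

open Literature.Analysis.FluidPDE Literature.Analysis.FluidPDE.TaoCascade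

/-- **Parity ⇒ the trigger-free subspace is force-free on triggers.** If every structure constant of `α`
with an odd number of slots equal to `i₁` vanishes, and the family `X` charges no `i₁`-mode at time `t`,
then `quadTerm ε₀ α X i₁ n t = 0` for every shell `n`. [folklore] -/
theorem quadTerm_trigger_eq_zero_of_parity {ε₀ : ℝ} {m : ℕ}
    {α : Fin m → Fin m → Fin m → ℤ × ℤ × ℤ → ℝ} {i₁ : Fin m}
    (hpar : ∀ (j₁ j₂ j₃ : Fin m) (μ : ℤ × ℤ × ℤ), Xor (Xor (j₁ = i₁) (j₂ = i₁)) (j₃ = i₁) →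
      α j₁ j₂ j₃ μ = 0)
    {X : Fin m → ℤ → ℝ → ℝ} {t : ℝ} (hX : ∀ n, X i₁ n t = 0) (n : ℤ) :
    quadTerm ε₀ α X i₁ n t = 0 := by
  unfold quadTerm
  refine Finset.sum_eq_zero fun j₁ _ => Finset.sum_eq_zero fun j₂ _ =>
    Finset.sum_eq_zero fun μ _ => ?_
  by_cases h₁ : j₁ = i₁
  · subst h₁
    rw [hX, zero_mul, mul_zero]
  · by_cases h₂ : j₂ = i₁
    · subst h₂
      rw [hX, mul_zero, mul_zero]
    · have hodd : Xor (Xor (j₁ = i₁) (j₂ = i₁)) (i₁ = i₁) := by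
        simp [Xor, h₁, h₂]
      rw [hpar j₁ j₂ i₁ μ hodd, zero_mul, zero_mul]

/-- **Item stmt-NavierStokesRegularity-22785: the (parity) clause makes the trigger-free subspace invariant for
both tables of the chain.** Under the crux's (parity) hypothesis for `(α₀, σ)` with trigger mode `i₁`, any
family with no trigger charged feels no force on any trigger, for `α₀`, for `σ`, and hence for every pinned
table `α₀ + βσ`. [folklore] -/
theorem triggerChainFrontStep_triggerFree_forceFree
    (α₀ σ : Fin 4 → Fin 4 → Fin 4 → ℤ × ℤ × ℤ → ℝ) (i₁ : Fin 4)
    (hpar : ∀ (j₁ j₂ j₃ : Fin 4) (μ : ℤ × ℤ × ℤ), Xor (Xor (j₁ = i₁) (j₂ = i₁)) (j₃ = i₁) →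
      α₀ j₁ j₂ j₃ μ = 0 ∧ σ j₁ j₂ j₃ μ = 0)
    (β : ℝ) {X : Fin 4 → ℤ → ℝ → ℝ} {t : ℝ} (hX : ∀ n, X i₁ n t = 0) (n : ℤ) :
    quadTerm 1 α₀ X i₁ n t = 0 ∧ quadTerm 1 σ X i₁ n t = 0 ∧
      quadTerm 1 (fun j₁ j₂ j₃ μ => α₀ j₁ j₂ j₃ μ + β * σ j₁ j₂ j₃ μ) X i₁ n t = 0 := by
  refine ⟨quadTerm_trigger_eq_zero_of_parity (fun j₁ j₂ j₃ μ h => (hpar j₁ j₂ j₃ μ h).1) hX n,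
    quadTerm_trigger_eq_zero_of_parity (fun j₁ j₂ j₃ μ h => (hpar j₁ j₂ j₃ μ h).2) hX n,
    quadTerm_trigger_eq_zero_of_parity (fun j₁ j₂ j₃ μ h => ?_) hX n⟩
  simp only [(hpar j₁ j₂ j₃ μ h).1, (hpar j₁ j₂ j₃ μ h).2, mul_zero, add_zero]

end Summit.NavierStokesRegularity.NavierStokesRegularity.Theorems

end
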